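import Mathlib
import Literature.NumberTheory.LFunctions.Zhang2022.TypedSection12BRel
import Literature.NumberTheory.LFunctions.Zhang2022.Section12Mid1225
import Literature.NumberTheory.LFunctions.Zhang2022.Section8FrontEnd44ReductionRel
import HarnessLib

/-!
# Zhang (2022) §12, Lemmas 12.2–12.3 in the relative reading: absolute ⇒ relative comparison edges, and the
# middle range of `S_j(𝐚₁₂,𝐚₂₅)` from the node `Eq1211W`

Topic `Literature/NumberTheory/LFunctions/Zhang2022` (Landau–Siegel audit tree; verdict-neutral).
Y. Zhang, *Discrete mean estimates and the Landau–Siegel zero*, arXiv:2211.02515v1 (2022)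
[Zhang2022LandauSiegel] — **an unrefereed manuscript under adjudication**; ZHANG-L lane, WP12 (typer seat,
task T2). THEOREMS ONLY (no new definition, no new fact); companion of the statement file
`TypedSection12BRel`. Kernel-checked (using the tree's `Section8FrontEnd44ReductionRel.one_le_relFac` / `relFac_le_prod`): the comparison edges `u024Rel_of_u024`, `u025Rel_of_u025`,
`u026readRel_of_u026read`, `u030Rel_of_u030`, `eq1211W_of_eq1211`, and the Euler-majorant lemmas
`prod_one_add_div_mono`, `one_le_prod_one_add_div` (the printed absolute claims of
`TypedSection12B` imply the relative readings; for (12.11): `α𝓛 = π𝓛⁻⁸ ≤ π𝓛⁻⁴`, `(dr/φ(dr))⁴ ≥ 1`); and the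
one-line wrapper **`mid1225_of_eq1211W : 0 ≤ c′ → Eq1211W c′ → Typed.Sec12C.Mid1225 c′`** onto zl-w12-p1's landed
edge `Typed.Sec12C.mid1225_of_eq1211_weak4` (p477334) — the v19 leaf `hMid` is a theorem of the node `Eq1211W`.
(`|Π(d,r)| ≤ (∏_{q∣dr}(1−q⁻¹)⁻¹)²` is the tree's `Typed.Sec10Rel.norm_PiW_le_relFactor`, not restated.)
Nothing here asserts any CLAIM, or anything about Theorems 1–2 of the manuscript or Landau–Siegel zeros.

## References

* Y. Zhang, arXiv:2211.02515v1 (2022), §12 pp. 69–71; §8 Lemma 8.3 p. 46.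
  [cite: Zhang2022LandauSiegel, §12 Lemmas 12.2–12.3]
-/

noncomputable section

open Complex Real ComplexConjugate

namespace Literature.NumberTheory.LFunctions.Zhang2022.Typed.Sec12B

open Literature.NumberTheory.LFunctions.Zhang2022.Skeleton

/-! ## The factors `(n/φ(n))⁴` and `∏_{q∣n}(1 + A/q)` (the factor `(∏_{q∣dr}(1−q⁻¹)⁻¹)² ≥ 1` and
`≤ ∏(1+6/q)` are the tree's `Section8FrontEnd44ReductionRel.one_le_relFac` / `relFac_le_prod`) -/

section RelFactor

/-- `1 ≤ (n/φ(n))⁴` for `n ≥ 1` (the factor of `Eq1211W`). [folklore] -/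
private theorem one_le_self_div_totient_pow_four {n : ℕ} (hn : 1 ≤ n) : 1 ≤ (((n : ℕ) : ℝ) / Nat.totient n) ^ 4 := by
  have hφ : (0 : ℝ) < Nat.totient n := by exact_mod_cast Nat.totient_pos.mpr (by omega)
  have h1 : 1 ≤ ((n : ℕ) : ℝ) / Nat.totient n := by
    rw [le_div_iff₀ hφ, one_mul]; exact_mod_cast Nat.totient_le n
  exact one_le_pow₀ h1

end RelFactor

/-! ## Absolute ⇒ relative comparison edges (the factor is `≥ 1`) -/

section Comparison

variable {c' : ℝ}

/-- `D ≥ 3` eventually. [folklore] -/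
private theorem forAllLarge_three_le : ForAllLarge fun D _ _ => 3 ≤ D :=
  ⟨3, fun _ _ _ hD _ _ => hD⟩

/-- A bound `C·E` upgrades to `|C|·E·R` for any `R ≥ 1` (`E ≥ 0`). [folklore] -/
private theorem le_abs_mul_mul_of_one_le {x C E R : ℝ} (hE : 0 ≤ E) (h : x ≤ C * E) (hR : 1 ≤ R) :
    x ≤ |C| * E * R := by
  calc x ≤ C * E := h
    _ ≤ |C| * E := mul_le_mul_of_nonneg_right (le_abs_self C) hE
    _ = |C| * E * 1 := (mul_one _).symm
    _ ≤ |C| * E * R := mul_le_mul_of_nonneg_left hR (mul_nonneg (abs_nonneg C) hE)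

/-- `𝓛ᵏ⁻¹ ≥ 0`. [folklore] -/
private theorem ell_pow_inv_nonneg (D k : ℕ) : 0 ≤ (ell D ^ k)⁻¹ :=
  inv_nonneg.mpr (pow_nonneg (Real.log_natCast_nonneg D) k)

/-- The absolute u024 implies the relative reading. [cite: Zhang2022LandauSiegel, §12 proof of Lemma 12.2, p.69] -/
theorem u024Rel_of_u024 (h : U024 c') : U024Rel c' := by
  obtain ⟨C, hC⟩ := h
  refine ⟨|C|, hC.mono fun D _ χ _ _ hS hA j hj d r hd hr h1 w hw => ?_⟩
  obtain ⟨e1, e2⟩ := hS hA j hj d r hd hr h1 w hw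
  exact ⟨le_abs_mul_mul_of_one_le (ell_pow_inv_nonneg D 15) e1 (Section8FrontEnd44ReductionRel.one_le_relFac _),
    le_abs_mul_mul_of_one_le (ell_pow_inv_nonneg D 15) e2 (Section8FrontEnd44ReductionRel.one_le_relFac _)⟩

/-- The absolute u025 implies the relative reading (first conjunct). [cite: Zhang2022LandauSiegel, §12 proof of Lemma 12.2, p.69] -/
theorem u025Rel_of_u025 (h : U025 c') : U025Rel c' := by
  obtain ⟨C, hC⟩ := h
  refine ⟨|C|, hC.mono fun D _ χ _ _ hS hA j hj d r hd hr h1 w hw => ?_⟩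
  exact le_abs_mul_mul_of_one_le (ell_pow_inv_nonneg D 15) (hS hA j hj d r hd hr h1 w hw).1
    (Section8FrontEnd44ReductionRel.one_le_relFac _)

/-- The absolute u026 (with its factor) implies the relative reading. [cite: Zhang2022LandauSiegel, §12 proof of Lemma 12.2, pp.69–70] -/
theorem u026readRel_of_u026read (h : U026read c') : U026readRel c' := by
  obtain ⟨C, hC⟩ := h
  refine ⟨|C|, hC.mono fun D _ χ _ _ hS hA j hj d r hd hr h1 => ?_⟩
  exact le_abs_mul_mul_of_one_le (ell_pow_inv_nonneg D 6) (hS hA j hj d r hd hr h1) (Section8FrontEnd44ReductionRel.one_le_relFac _)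

/-- The absolute u030 implies the relative reading. [cite: Zhang2022LandauSiegel, §12 proof of Lemma 12.3, p.70] -/
theorem u030Rel_of_u030 (h : U030 c') : U030Rel c' := by
  obtain ⟨C, hC⟩ := h
  refine ⟨|C|, hC.mono fun D _ χ _ _ hS hA j hj d r hd hr h1 h2 w hw => ?_⟩
  exact le_abs_mul_mul_of_one_le (ell_pow_inv_nonneg D 15) (hS hA j hj d r hd hr h1 h2 w hw)
    (Section8FrontEnd44ReductionRel.one_le_relFac _)

/-- The printed (12.11) (`≤ C·α·𝓛 = Cπ𝓛⁻⁸`) implies the weak relative reading `Eq1211W` (`≤ C′𝓛⁻⁴·(dr/φ(dr))⁴`).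
[cite: Zhang2022LandauSiegel, §12 (12.11) p.69] -/
theorem eq1211W_of_eq1211 (h : Eq1211 c') : Eq1211W c' := by
  obtain ⟨C, hC⟩ := h
  refine ⟨|C| * π, ?_⟩
  refine (hC.and forAllLarge_three_le).mono fun D _ χ _ _ hS hA j hj d r hd hr h1 h2 => ?_
  obtain ⟨hS, hD3⟩ := hS
  have hℓ : 1 < ell D := one_lt_ell hD3
  have hℓ0 : 0 < ell D := by linarith
  have key := hS hA j hj d r hd hr h1.le h2
  have hα : alpha D * ell D = π / ell D ^ 8 := by
    rw [alpha, bigP, Real.log_exp]; field_simp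
  have hle : π / ell D ^ 8 ≤ π * (ell D ^ 4)⁻¹ := by
    rw [div_eq_mul_inv]
    apply mul_le_mul_of_nonneg_left _ Real.pi_pos.le
    apply inv_anti₀ (pow_pos hℓ0 4)
    exact pow_le_pow_right₀ hℓ.le (by norm_num)
  have hdr : 1 ≤ d * r := Nat.one_le_iff_ne_zero.mpr (Nat.mul_ne_zero (by omega) (by omega))
  calc ‖sum122 c' χ j d r‖ ≤ C * alpha D * ell D := key
    _ = C * (π / ell D ^ 8) := by rw [mul_assoc, hα]
    _ ≤ |C| * (π / ell D ^ 8) := mul_le_mul_of_nonneg_right (le_abs_self C) (by positivity)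
    _ ≤ |C| * (π * (ell D ^ 4)⁻¹) := mul_le_mul_of_nonneg_left hle (abs_nonneg C)
    _ = |C| * π * (ell D ^ 4)⁻¹ * 1 := by ring
    _ ≤ |C| * π * (ell D ^ 4)⁻¹ * ((((d * r : ℕ) : ℝ)) / Nat.totient (d * r)) ^ 4 :=
        mul_le_mul_of_nonneg_left (one_le_self_div_totient_pow_four hdr) (by positivity)

/-- Monotonicity of the Euler majorant in `A ≥ 0`: `∏_{q∣n}(1 + A/q) ≤ ∏_{q∣n}(1 + A′/q)` for `0 ≤ A ≤ A′`.
[cite: Zhang2022LandauSiegel, §8 p.47] -/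
theorem prod_one_add_div_mono (n : ℕ) {A A' : ℝ} (hA : 0 ≤ A) (hAA' : A ≤ A') :
    ∏ q ∈ n.primeFactors, (1 + A / (q : ℝ)) ≤ ∏ q ∈ n.primeFactors, (1 + A' / (q : ℝ)) := by
  refine Finset.prod_le_prod (fun q _ => by positivity) fun q hq => ?_
  have hq0 : (0 : ℝ) < q := by exact_mod_cast (Nat.prime_of_mem_primeFactors hq).pos
  gcongr

/-- `1 ≤ ∏_{q∣n}(1 + A/q)` for `A ≥ 0`. [cite: Zhang2022LandauSiegel, §8 p.47] -/
theorem one_le_prod_one_add_div (n : ℕ) {A : ℝ} (hA : 0 ≤ A) :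
    1 ≤ ∏ q ∈ n.primeFactors, (1 + A / (q : ℝ)) :=
  le_of_eq_of_le (Finset.prod_const_one (s := n.primeFactors)).symm
    (Finset.prod_le_prod (fun _ _ => zero_le_one) fun q _ => by
      have : 0 ≤ A / (q : ℝ) := by positivity
      linarith)

end Comparison

/-! ## The middle range of `S_j(𝐚₁₂,𝐚₂₅)` from the node `Eq1211W` (zl-w12-p1's edge, by name) -/

section MidWrapper

/-- **`Eq1211W → Mid1225`** — the landed edge `Typed.Sec12C.mid1225_of_eq1211_weak4` (zl-w12-p1, p477334) consumes
exactly the node `Eq1211W` (its inline hypothesis verbatim), for `c′ ≥ 0`.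
[cite: Zhang2022LandauSiegel, §12 (12.12) p.71] -/
theorem mid1225_of_eq1211W {c' : ℝ} (hc' : 0 ≤ c') (h : Eq1211W c') : Typed.Sec12C.Mid1225 c' :=
  Typed.Sec12C.mid1225_of_eq1211_weak4 c' hc' h

end MidWrapper

end Literature.NumberTheory.LFunctions.Zhang2022.Typed.Sec12B
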